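import Mathlib
import HarnessLib
import Summits.ABC.ABC.Theses.CongruentialReceptacle

/-!
# Crux `CompactBalanceTransfer` (stmt-ABC-1725) — a FIRST TOOTH: `H` proves abc on an infinite `a = 1` family

Support file (`--supports stmt-ABC-1725`) of the line lead `prover-line-stmt-ABC-1725-c10-0` (2026-08-17), line `birth`.

`H := ∀ κ > 0, ∀ ε > 0, ∃ C, ∀ abc-triples with κc ≤ a, κc ≤ b : c < C·rad(abc)^(1+ε)` (abc on every compactly
balanced cell) is the hypothesis of the crux `CompactBalanceTransfer := H → ABC`. The crux census
(`Cruxes/CompactBalanceTransfer/STRATEGY-CENSUS.md` §1, `Obstructions-r2-k5.md` "FIRST-TOOTH TEST") records that *no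
consequence of `H` about DEEP triples stated in `a, b, c, rad(abc)` alone was known* ("every consequence is `H` on a
balanced COMPANION = a lower bound for the radical of a FRESH integer"), and that `H`'s toll-free reach is bounded depth.
This file kernel-checks a counterexample to that reading:

* `abc_aEqOne_cubicFamily_of_balancedABC` — **`H` implies abc, with the SAME `ε`, on the infinite family of
  consecutive-integer triples `(1, c_m − 1, c_m)`, `c_m = 3m(2m+1)(3m+1)` (`m ≥ 1`)** — the deepest cell `a = 1`
  (depth = full height), where unconditionally nothing beyond Stewart–Yu is known and where even the Frey–Szpiro
  hypothesis `F` of the line's stub 1 only gives exponent `3/2`.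
  Mechanism ("cusp-resolving pair"): on `P¹_x` take `β'(x) = x³` (Belyi, cusp fibre `Σ' = {0, ∞, 1, ω, ω²}`) and
  `β(x) = 3x(x−1)/(2x+1)³` (degree 3, `β − 1 = −(8x+1)(x²+x+1)/(2x+1)³`, so `Σ' ⊆ β⁻¹{0,1,∞}` and `β` has a TRIPLE
  pole at the extra rational point `P = −1/2 ∉ Σ'`). At `x = −m/(2m+1)`: `β = 3m(2m+1)(3m+1) = c_m` and
  `β − 1 = (6m−1)(3m²+3m+1)`, the deep triple `1 + (6m−1)(3m²+3m+1) = 3m(2m+1)(3m+1)`; and `β' = −m³/(2m+1)³` is the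
  BALANCED partner `m³ + (2m+1)³ = (3m+1)(3m²+3m+1)` (ratio → 1/9) whose prime support `{m, 2m+1, 3m+1, 3m²+3m+1}`
  is CONTAINED in the deep triple's and whose height is comparable (`c_m ≤ 2·c'_m`). So `H` at `κ = 1/28` bounds
  `c'_m`, hence `c_m`, by the radical of the deep triple — no fresh integer, no toll.
* `abcThreeHalves_aEqOne_eightyOneFamily_of_balancedABC` — the same with the degree-2 Belyi map `β' = x²` and the
  cubic `β = (x³ − x)/(x − 1/2)³`: `H` gives exponent `(3/2)(1+ε)` (the degree ratio `deg β / deg β'`) on the `a = 1`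
  family `1 + 8p(p−1)(3p−1) = (2p−1)(12p²−10p−1)` (`p = 2`: the triple `(1, 80, 81)`, partner `(4, 5, 9)`), i.e.
  exactly the Frey–Szpiro strength `F` that stub 1 (`H → F`) asks for, on this family.
* `lt_of_balanced_partner` — the one-line transfer principle both rest on: a number `c ≤ M·c'` whose companion
  radical dominates the radical of a `κ`-balanced abc-triple `(a', b', c')` inherits that triple's `H`-bound.

What this is NOT: a proof of any stub. The reachable triples form THIN sets `β(P¹(ℚ))` (one-parameter polynomial
families here). General law behind both examples (for the census; proved here only in the two instances): a pair
(`β'` Belyi of degree `n'`; `β` of degree `n` over `ℚ` with `β'⁻¹{0,1,∞} ⊆ β⁻¹{0,1,∞}` and an extra rational cusp point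
`P` of ramification `e`) transfers `H` to the triples `β(y)`, `y ∈ ℚ` near `P`, of relative depth `θ = e/n`, with
abc-exponent `(1+ε)·n/n'`; such pairs have `2n − n' − e` moduli, so `θ = 1 ∧ n' = n` is rigid (the cubic pair is the
unique rational solution for `n = 3`) while `n' = 2, e = n = 3` is the one-parameter family `β_P = (x³−x)/(x−P)³`.
Covering ALL of `a = 1` this way meets two obstacles (representing every `c` as some `β_t(y)`; growth in `t` of the
height-comparison constant) — see `Cruxes/CompactBalanceTransfer/Lines/birth-lead-c10.md`.
All statements spelled out (no `def`s); unconditional; standard axioms; no named facts. [folklore]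
-/

-- `Summit.<Summit>.<Problem>`: for the single-conjunct summit `ABC` the duplicate `ABC.ABC` is mandated.
set_option linter.dupNamespace false

namespace Summit.ABC.ABC.Theorems.CompactBalanceTransfer.FirstTooth

open Literature.NumberTheory.DiophantineGeometry

/-! ## Radical bookkeeping -/

/-- If `a'b'c'` divides a power of `abc ≠ 0`, then `rad(a'b'c') ≤ rad(abc)` (radicals computed in `ℕ`). [folklore] -/
theorem rad_le_of_dvd_pow {a b c a' b' c' n : ℕ} (hn : n ≠ 0) (h0 : a * b * c ≠ 0)
    (h : a' * b' * c' ∣ (a * b * c) ^ n) : rad a' b' c' ≤ rad a b c := by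
  rw [rad_def, rad_def]
  have h1 : UniqueFactorizationMonoid.radical (a' * b' * c') ∣
      UniqueFactorizationMonoid.radical ((a * b * c) ^ n) :=
    UniqueFactorizationMonoid.radical_dvd_radical h (pow_ne_zero n h0)
  rw [UniqueFactorizationMonoid.radical_pow _ hn] at h1
  exact Nat.le_of_dvd (Nat.radical_pos _) h1

/-! ## The transfer principle -/

/-- **Transfer along a balanced partner.** Under `H`, for all `κ, ε > 0` there is `C ≥ 0` such that every
`κ`-balanced abc-triple `(a', b', c')` satisfies `c' < C·rad(abc)^(1+ε)` for ANY `a, b, c` with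
`rad(a'b'c') ≤ rad(abc)` — so a triple `(a, b, c)` of height comparable to `c'` inherits `H`'s bound. [folklore] -/
theorem lt_of_balanced_partner
    (hH : ∀ κ : ℝ, 0 < κ → ∀ ε : ℝ, 0 < ε → ∃ C : ℝ, ∀ a b c : ℕ, IsABCTriple a b c →
      κ * (c : ℝ) ≤ (a : ℝ) → κ * (c : ℝ) ≤ (b : ℝ) → (c : ℝ) < C * ((rad a b c : ℕ) : ℝ) ^ (1 + ε))
    (κ : ℝ) (hκ : 0 < κ) (ε : ℝ) (hε : 0 < ε) :
    ∃ C : ℝ, 0 ≤ C ∧ ∀ a b c a' b' c' : ℕ, IsABCTriple a' b' c' →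
      κ * (c' : ℝ) ≤ (a' : ℝ) → κ * (c' : ℝ) ≤ (b' : ℝ) → rad a' b' c' ≤ rad a b c →
        (c' : ℝ) < C * ((rad a b c : ℕ) : ℝ) ^ (1 + ε) := by
  obtain ⟨C, hC⟩ := hH κ hκ ε hε
  refine ⟨max C 0, le_max_right _ _, ?_⟩
  intro a b c a' b' c' hT ha hb hrad
  have h1 : (c' : ℝ) < C * ((rad a' b' c' : ℕ) : ℝ) ^ (1 + ε) := hC a' b' c' hT ha hb
  have hr' : (0 : ℝ) ≤ ((rad a' b' c' : ℕ) : ℝ) := by positivity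
  have hr : ((rad a' b' c' : ℕ) : ℝ) ≤ ((rad a b c : ℕ) : ℝ) := by exact_mod_cast hrad
  have hε1 : (0 : ℝ) ≤ 1 + ε := by linarith
  have h2 : C * ((rad a' b' c' : ℕ) : ℝ) ^ (1 + ε) ≤ max C 0 * ((rad a b c : ℕ) : ℝ) ^ (1 + ε) :=
    calc C * ((rad a' b' c' : ℕ) : ℝ) ^ (1 + ε)
        ≤ max C 0 * ((rad a' b' c' : ℕ) : ℝ) ^ (1 + ε) :=
          mul_le_mul_of_nonneg_right (le_max_left _ _) (Real.rpow_nonneg hr' _)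
      _ ≤ max C 0 * ((rad a b c : ℕ) : ℝ) ^ (1 + ε) :=
          mul_le_mul_of_nonneg_left (Real.rpow_le_rpow hr' hr hε1) (le_max_right _ _)
  exact lt_of_lt_of_le h1 h2

/-! ## The cubic pair `β' = x³`, `β = 3x(x−1)/(2x+1)³`: abc with the same `ε` on `c = 3m(2m+1)(3m+1)` -/

/-- The balanced partner `m³ + (2m+1)³ = (3m+1)(3m²+3m+1)` is an abc-triple. [folklore] -/
theorem partner_cubic_isABCTriple (m : ℕ) (hm : 1 ≤ m) :
    IsABCTriple (m ^ 3) ((2 * m + 1) ^ 3) ((3 * m + 1) * (3 * m ^ 2 + 3 * m + 1)) := by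
  refine ⟨by positivity, by positivity, by ring, ?_⟩
  exact Nat.Coprime.pow 3 3 ((Nat.coprime_mul_right_add_right m 1 2).mpr (Nat.coprime_one_right m))

/-- The consecutive pair `1 + (c_m − 1) = c_m`, `c_m = 3m(2m+1)(3m+1) ≥ 36`, is an abc-triple. [folklore] -/
theorem cubicFamily_isABCTriple (m : ℕ) (hm : 1 ≤ m) :
    IsABCTriple 1 (3 * m * (2 * m + 1) * (3 * m + 1) - 1) (3 * m * (2 * m + 1) * (3 * m + 1)) := by
  have h2 : 1 * 1 * 2 ≤ 3 * m * (2 * m + 1) * (3 * m + 1) :=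
    Nat.mul_le_mul (Nat.mul_le_mul (by omega) (by omega)) (by omega)
  generalize 3 * m * (2 * m + 1) * (3 * m + 1) = c at *
  exact ⟨Nat.one_pos, by omega, by omega, Nat.coprime_one_left _⟩

/-- The factorisation `c_m − 1 = (6m−1)(3m²+3m+1)` behind the shared support (stated for `m = k+1`). [folklore] -/
theorem cubicFamily_pred_eq (k : ℕ) :
    3 * (k + 1) * (2 * (k + 1) + 1) * (3 * (k + 1) + 1) - 1 =
      (6 * k + 5) * (3 * (k + 1) ^ 2 + 3 * (k + 1) + 1) := by
  have h : 3 * (k + 1) * (2 * (k + 1) + 1) * (3 * (k + 1) + 1) =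
      (6 * k + 5) * (3 * (k + 1) ^ 2 + 3 * (k + 1) + 1) + 1 := by ring
  omega

/-- **Shared support.** `rad(m³·(2m+1)³·c'_m) ≤ rad(1·(c_m−1)·c_m)`, because `m³ (2m+1)³ (3m+1)(3m²+3m+1)` divides
`((c_m − 1)·c_m)³`. [folklore] -/
theorem rad_partner_le_rad_cubicFamily (m : ℕ) (hm : 1 ≤ m) :
    rad (m ^ 3) ((2 * m + 1) ^ 3) ((3 * m + 1) * (3 * m ^ 2 + 3 * m + 1)) ≤
      rad 1 (3 * m * (2 * m + 1) * (3 * m + 1) - 1) (3 * m * (2 * m + 1) * (3 * m + 1)) := by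
  obtain ⟨k, rfl⟩ : ∃ k, m = k + 1 := ⟨m - 1, by omega⟩
  rw [cubicFamily_pred_eq k]
  refine rad_le_of_dvd_pow (n := 3) (by norm_num) (by positivity) ?_
  exact Dvd.intro (27 * (6 * k + 5) ^ 3 * (3 * (k + 1) ^ 2 + 3 * (k + 1) + 1) ^ 2 * (3 * (k + 1) + 1) ^ 2)
    (by ring)

/-- **FIRST TOOTH (exponent `1+ε` on an `a = 1` family).** `H` (abc on every compactly balanced cell) implies abc —
with the same `ε` — for every consecutive-integer triple `(1, c_m − 1, c_m)`, `c_m = 3m(2m+1)(3m+1)`, `m ≥ 1`.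
Only `H` at `κ = 1/28` is used; the constant is twice `H`'s. [folklore] -/
theorem abc_aEqOne_cubicFamily_of_balancedABC :
    (∀ κ : ℝ, 0 < κ → ∀ ε : ℝ, 0 < ε → ∃ C : ℝ, ∀ a b c : ℕ, IsABCTriple a b c →
      κ * (c : ℝ) ≤ (a : ℝ) → κ * (c : ℝ) ≤ (b : ℝ) → (c : ℝ) < C * ((rad a b c : ℕ) : ℝ) ^ (1 + ε)) →
    ∀ ε : ℝ, 0 < ε → ∃ C : ℝ, ∀ m : ℕ, 1 ≤ m →
      IsABCTriple 1 (3 * m * (2 * m + 1) * (3 * m + 1) - 1) (3 * m * (2 * m + 1) * (3 * m + 1)) ∧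
      ((3 * m * (2 * m + 1) * (3 * m + 1) : ℕ) : ℝ) <
        C * ((rad 1 (3 * m * (2 * m + 1) * (3 * m + 1) - 1) (3 * m * (2 * m + 1) * (3 * m + 1)) : ℕ) : ℝ) ^
          (1 + ε) := by
  intro hH ε hε
  obtain ⟨C, -, hC⟩ := lt_of_balanced_partner hH (1 / 28) (by norm_num) ε hε
  refine ⟨2 * C, fun m hm => ⟨cubicFamily_isABCTriple m hm, ?_⟩⟩
  have hT := partner_cubic_isABCTriple m hm
  have hrad := rad_partner_le_rad_cubicFamily m hm
  -- balance (`κ = 1/28`) and height comparison (`c_m ≤ 2 c'_m`), proved in `ℕ`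
  have hn1 : (3 * m + 1) * (3 * m ^ 2 + 3 * m + 1) ≤ 28 * m ^ 3 := by
    obtain ⟨k, rfl⟩ : ∃ k, m = k + 1 := ⟨m - 1, by omega⟩
    ring_nf
    nlinarith [sq_nonneg k, Nat.zero_le (k ^ 3), Nat.zero_le (k ^ 2), Nat.zero_le k]
  have hn2 : (3 * m + 1) * (3 * m ^ 2 + 3 * m + 1) ≤ 28 * (2 * m + 1) ^ 3 := by
    ring_nf
    nlinarith [Nat.zero_le (m ^ 3), Nat.zero_le (m ^ 2), Nat.zero_le m]
  have hn3 : 3 * m * (2 * m + 1) * (3 * m + 1) ≤ 2 * ((3 * m + 1) * (3 * m ^ 2 + 3 * m + 1)) := by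
    ring_nf
    nlinarith [Nat.zero_le (m ^ 3), Nat.zero_le (m ^ 2), Nat.zero_le m]
  have hbal1 : (1 / 28 : ℝ) * ((((3 * m + 1) * (3 * m ^ 2 + 3 * m + 1) : ℕ)) : ℝ) ≤ ((m ^ 3 : ℕ) : ℝ) := by
    have := (Nat.cast_le (α := ℝ)).mpr hn1
    push_cast at this ⊢
    linarith
  have hbal2 : (1 / 28 : ℝ) * ((((3 * m + 1) * (3 * m ^ 2 + 3 * m + 1) : ℕ)) : ℝ) ≤
      (((2 * m + 1) ^ 3 : ℕ) : ℝ) := by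
    have := (Nat.cast_le (α := ℝ)).mpr hn2
    push_cast at this ⊢
    linarith
  have hcmp : ((3 * m * (2 * m + 1) * (3 * m + 1) : ℕ) : ℝ) ≤
      2 * ((((3 * m + 1) * (3 * m ^ 2 + 3 * m + 1) : ℕ)) : ℝ) := by
    have := (Nat.cast_le (α := ℝ)).mpr hn3
    push_cast at this ⊢
    linarith
  have h := hC 1 (3 * m * (2 * m + 1) * (3 * m + 1) - 1) (3 * m * (2 * m + 1) * (3 * m + 1))
    (m ^ 3) ((2 * m + 1) ^ 3) ((3 * m + 1) * (3 * m ^ 2 + 3 * m + 1)) hT hbal1 hbal2 hrad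
  calc ((3 * m * (2 * m + 1) * (3 * m + 1) : ℕ) : ℝ)
      ≤ 2 * ((((3 * m + 1) * (3 * m ^ 2 + 3 * m + 1) : ℕ)) : ℝ) := hcmp
    _ < 2 * (C * ((rad 1 (3 * m * (2 * m + 1) * (3 * m + 1) - 1) (3 * m * (2 * m + 1) * (3 * m + 1)) : ℕ) : ℝ) ^
          (1 + ε)) := by linarith [h]
    _ = 2 * C * ((rad 1 (3 * m * (2 * m + 1) * (3 * m + 1) - 1) (3 * m * (2 * m + 1) * (3 * m + 1)) : ℕ) : ℝ) ^
          (1 + ε) := by ring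

/-! ## The pair `β' = x²`, `β = (x³−x)/(x−1/2)³`: exponent `3/2` on `c = (2p−1)(12p²−10p−1) = 1 + 8p(p−1)(3p−1)` -/

/-- The balanced partner `p² + (p−1)(3p−1) = (2p−1)²` is an abc-triple (stated for `p = k+2`). [folklore] -/
theorem partner_square_isABCTriple (k : ℕ) :
    IsABCTriple ((k + 2) ^ 2) ((k + 1) * (3 * k + 5)) ((2 * k + 3) ^ 2) := by
  refine ⟨by positivity, by positivity, by ring, ?_⟩
  have h1 : Nat.Coprime (k + 2) (k + 1) := by
    have e : k + 2 = 1 * (k + 1) + 1 := by ring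
    have : Nat.Coprime (k + 1) (k + 2) := by
      rw [e]; exact (Nat.coprime_mul_right_add_right (k + 1) 1 1).mpr (Nat.coprime_one_right _)
    exact this.symm
  have h2 : Nat.Coprime (k + 2) (2 * k + 3) := by
    have e : 2 * k + 3 = 1 * (k + 2) + (k + 1) := by ring
    rw [e]; exact (Nat.coprime_mul_right_add_right (k + 2) (k + 1) 1).mpr h1
  have h3 : Nat.Coprime (k + 2) (3 * k + 5) := by
    have e : 3 * k + 5 = 1 * (k + 2) + (2 * k + 3) := by ring
    rw [e]; exact (Nat.coprime_mul_right_add_right (k + 2) (2 * k + 3) 1).mpr h2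
  exact Nat.Coprime.pow_left 2 (Nat.Coprime.mul_right h1 h3)

/-- The consecutive pair `1 + 8p(p−1)(3p−1) = (2p−1)(12p²−10p−1)` (stated for `p = k+2`:
`1 + 8(k+2)(k+1)(3k+5) = (2k+3)(12k²+38k+27)`) is an abc-triple. [folklore] -/
theorem eightyOneFamily_isABCTriple (k : ℕ) :
    IsABCTriple 1 (8 * (k + 2) * (k + 1) * (3 * k + 5)) ((2 * k + 3) * (12 * k ^ 2 + 38 * k + 27)) :=
  ⟨Nat.one_pos, by positivity, by ring, Nat.coprime_one_left _⟩

/-- **Shared support** for the second pair: `p²·(p−1)(3p−1)·(2p−1)²` divides `(b·c)²` for the deep triple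
`(1, b, c) = (1, 8p(p−1)(3p−1), (2p−1)(12p²−10p−1))`, so the partner's radical is at most the deep one's. [folklore] -/
theorem rad_partner_le_rad_eightyOneFamily (k : ℕ) :
    rad ((k + 2) ^ 2) ((k + 1) * (3 * k + 5)) ((2 * k + 3) ^ 2) ≤
      rad 1 (8 * (k + 2) * (k + 1) * (3 * k + 5)) ((2 * k + 3) * (12 * k ^ 2 + 38 * k + 27)) := by
  refine rad_le_of_dvd_pow (n := 2) (by norm_num) (by positivity) ?_
  exact Dvd.intro (64 * (k + 1) * (3 * k + 5) * (12 * k ^ 2 + 38 * k + 27) ^ 2) (by ring)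

/-- **Second tooth (exponent `3/2` = Frey–Szpiro strength on an `a = 1` family).** `H` implies
`c < C·rad(1·(c−1)·c)^((3/2)(1+ε))` for every `c = (2p−1)(12p²−10p−1) = 1 + 8p(p−1)(3p−1)`, `p ≥ 2`
(`p = 2`: `(1, 80, 81)` with partner `(4, 5, 9)`); the exponent is the degree ratio `3/2` of the pair
`β = (x³−x)/(x−1/2)³`, `β' = x²`. Only `H` at `κ = 1/9` is used. [folklore] -/
theorem abcThreeHalves_aEqOne_eightyOneFamily_of_balancedABC
    (hH : ∀ κ : ℝ, 0 < κ → ∀ ε : ℝ, 0 < ε → ∃ C : ℝ, ∀ a b c : ℕ, IsABCTriple a b c →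
      κ * (c : ℝ) ≤ (a : ℝ) → κ * (c : ℝ) ≤ (b : ℝ) → (c : ℝ) < C * ((rad a b c : ℕ) : ℝ) ^ (1 + ε)) :
    ∀ ε : ℝ, 0 < ε → ∃ C : ℝ, ∀ k : ℕ,
      (((2 * k + 3) * (12 * k ^ 2 + 38 * k + 27) : ℕ) : ℝ) <
        C * ((rad 1 (8 * (k + 2) * (k + 1) * (3 * k + 5)) ((2 * k + 3) * (12 * k ^ 2 + 38 * k + 27)) : ℕ) : ℝ) ^
          ((3 / 2) * (1 + ε)) := by
  intro ε hε
  obtain ⟨C, hC0, hC⟩ := lt_of_balanced_partner hH (1 / 9) (by norm_num) ε hε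
  refine ⟨4 * C ^ ((3 : ℝ) / 2), fun k => ?_⟩
  have hT := partner_square_isABCTriple k
  have hrad := rad_partner_le_rad_eightyOneFamily k
  set R : ℕ := rad 1 (8 * (k + 2) * (k + 1) * (3 * k + 5)) ((2 * k + 3) * (12 * k ^ 2 + 38 * k + 27)) with hR
  have hn1 : (2 * k + 3) ^ 2 ≤ 9 * (k + 2) ^ 2 := by
    ring_nf; nlinarith [Nat.zero_le (k ^ 2), Nat.zero_le k]
  have hn2 : (2 * k + 3) ^ 2 ≤ 9 * ((k + 1) * (3 * k + 5)) := by
    ring_nf; nlinarith [Nat.zero_le (k ^ 2), Nat.zero_le k]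
  have hbal1 : (1 / 9 : ℝ) * ((((2 * k + 3) ^ 2 : ℕ)) : ℝ) ≤ (((k + 2) ^ 2 : ℕ) : ℝ) := by
    have := (Nat.cast_le (α := ℝ)).mpr hn1
    push_cast at this ⊢
    linarith
  have hbal2 : (1 / 9 : ℝ) * ((((2 * k + 3) ^ 2 : ℕ)) : ℝ) ≤ ((((k + 1) * (3 * k + 5)) : ℕ) : ℝ) := by
    have := (Nat.cast_le (α := ℝ)).mpr hn2
    push_cast at this ⊢
    linarith
  -- `H` on the partner: (2k+3)² < C·R^(1+ε)
  have h1 : ((((2 * k + 3) ^ 2 : ℕ)) : ℝ) < C * ((R : ℕ) : ℝ) ^ (1 + ε) :=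
    hC 1 (8 * (k + 2) * (k + 1) * (3 * k + 5)) ((2 * k + 3) * (12 * k ^ 2 + 38 * k + 27))
      ((k + 2) ^ 2) ((k + 1) * (3 * k + 5)) ((2 * k + 3) ^ 2) hT hbal1 hbal2 hrad
  -- raise to the power 3/2 and compare heights: c ≤ 4·(2k+3)³ = 4·((2k+3)²)^(3/2)
  have hX0 : (0 : ℝ) ≤ (2 * k + 3 : ℝ) := by positivity
  have hq0 : (0 : ℝ) ≤ ((((2 * k + 3) ^ 2 : ℕ)) : ℝ) := by positivity
  have hR0 : (0 : ℝ) ≤ ((R : ℕ) : ℝ) := by positivity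
  have h3 : (((((2 * k + 3) ^ 2 : ℕ)) : ℝ)) ^ ((3 : ℝ) / 2) < (C * ((R : ℕ) : ℝ) ^ (1 + ε)) ^ ((3 : ℝ) / 2) :=
    Real.rpow_lt_rpow hq0 h1 (by norm_num)
  have h4 : (((((2 * k + 3) ^ 2 : ℕ)) : ℝ)) ^ ((3 : ℝ) / 2) = (2 * k + 3 : ℝ) ^ (3 : ℕ) := by
    have e1 : ((((2 * k + 3) ^ 2 : ℕ)) : ℝ) = (2 * k + 3 : ℝ) ^ ((2 : ℕ) : ℝ) := by
      rw [Real.rpow_natCast]; push_cast; ring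
    rw [e1, ← Real.rpow_mul hX0, ← Real.rpow_natCast _ 3]
    norm_num
  have h5 : (C * ((R : ℕ) : ℝ) ^ (1 + ε)) ^ ((3 : ℝ) / 2) =
      C ^ ((3 : ℝ) / 2) * ((R : ℕ) : ℝ) ^ ((3 / 2) * (1 + ε)) := by
    rw [Real.mul_rpow hC0 (Real.rpow_nonneg hR0 _), ← Real.rpow_mul hR0]
    ring_nf
  have hn3 : (2 * k + 3) * (12 * k ^ 2 + 38 * k + 27) ≤ 4 * (2 * k + 3) ^ 3 := by
    ring_nf; nlinarith [Nat.zero_le (k ^ 3), Nat.zero_le (k ^ 2), Nat.zero_le k]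
  have hcmp : ((((2 * k + 3) * (12 * k ^ 2 + 38 * k + 27) : ℕ)) : ℝ) ≤ 4 * (2 * k + 3 : ℝ) ^ (3 : ℕ) := by
    have := (Nat.cast_le (α := ℝ)).mpr hn3
    push_cast at this ⊢
    linarith
  have hC32 : (0 : ℝ) ≤ C ^ ((3 : ℝ) / 2) := Real.rpow_nonneg hC0 _
  calc ((((2 * k + 3) * (12 * k ^ 2 + 38 * k + 27) : ℕ)) : ℝ)
      ≤ 4 * (2 * k + 3 : ℝ) ^ (3 : ℕ) := hcmp
    _ = 4 * (((((2 * k + 3) ^ 2 : ℕ)) : ℝ)) ^ ((3 : ℝ) / 2) := by rw [h4]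
    _ < 4 * ((C * ((R : ℕ) : ℝ) ^ (1 + ε)) ^ ((3 : ℝ) / 2)) := by linarith [h3]
    _ = 4 * C ^ ((3 : ℝ) / 2) * ((R : ℕ) : ℝ) ^ ((3 / 2) * (1 + ε)) := by rw [h5]; ring

end Summit.ABC.ABC.Theorems.CompactBalanceTransfer.FirstTooth


/-!
## Appendix (lead c10, same day): the degree-2 pair — the Pythagorean tooth

The simplest cusp-resolving pair has degree `2`: `β'(t) = t²/(1+t²)` (the twisted real form of the degree-2 Belyi
map, cusp fibre `{0, ∞, ±i}`) and `β(t) = (1−t)²/(1+t²)` (double zero at the extra rational point `P = 1`), i.e. the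
identity `x² + y² = (y−x)² + 2xy`: the balanced triple `(x², y², x²+y²)` and the triple `((y−x)², 2xy, x²+y²)` have
the SAME `c` and nested supports. So `H` gives abc with exponent `1`, no toll and the same constant on the whole
two-parameter thin set `{(y−x)² + 2xy = x²+y² : κ'y ≤ x < y}` (`abc_pythagorean_of_balancedABC`), in particular on
`(1, 2m(m+1), m² + (m+1)²)` (`abc_aEqOne_consecutiveSquares_of_balancedABC`; `m = 1, 2, 3, …`: `(1,4,5)`, `(1,12,13)`,
`(1,24,25)`, …). In the census's own words: the correspondence's fresh factor `y − x` is set to `1` on a line, which is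
why no toll is paid — the overlooked case behind the "first-tooth test".
-/

namespace Summit.ABC.ABC.Theorems.CompactBalanceTransfer.FirstTooth

open Literature.NumberTheory.DiophantineGeometry

/-! ## The degree-2 pair `β' = t²/(1+t²)`, `β = (1−t)²/(1+t²)`: the Pythagorean tooth (exponent `1`, no toll, two parameters) -/

/-- The balanced partner `x² + y² = x² + y²` with `gcd(x,y) = 1` is an abc-triple. [folklore] -/
theorem partner_pythagorean_isABCTriple {x y : ℕ} (hx : 0 < x) (hy : 0 < y) (hxy : Nat.Coprime x y) :
    IsABCTriple (x ^ 2) (y ^ 2) (x ^ 2 + y ^ 2) :=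
  ⟨by positivity, by positivity, rfl, Nat.Coprime.pow 2 2 hxy⟩

/-- **Shared support**: `rad(x²·y²·(x²+y²)) ≤ rad((y−x)²·(2xy)·(x²+y²))` for `x < y`. [folklore] -/
theorem rad_partner_le_rad_pythagorean {x y : ℕ} (hx : 0 < x) (hxy : x < y) :
    rad (x ^ 2) (y ^ 2) (x ^ 2 + y ^ 2) ≤ rad ((y - x) ^ 2) (2 * x * y) (x ^ 2 + y ^ 2) := by
  have hyx : 0 < y - x := Nat.sub_pos_of_lt hxy
  have hy : 0 < y := lt_trans hx hxy
  refine rad_le_of_dvd_pow (n := 2) (by norm_num) ?_ ?_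
  · positivity
  · exact Dvd.intro (4 * (y - x) ^ 4 * (x ^ 2 + y ^ 2)) (by ring)

/-- **The Pythagorean tooth (two parameters, exponent `1`, no toll).** `H` implies, for every `κ' > 0` and
`ε > 0`, with ONE constant: `x² + y² < C·rad((y−x)²·2xy·(x²+y²))^(1+ε)` for all coprime `κ'y ≤ x < y` — i.e. abc
(same `ε`) for every triple `(y−x)² + 2xy = x² + y²` whose Pythagorean parametrisation is balanced, however small
`(y−x)²` is: the identity `x² + y² = (y−x)² + 2xy` relates it to the BALANCED triple `(x², y², x²+y²)` of the same
height whose support `{x, y, x²+y²}` it contains (the correspondence's fresh factor `y − x` lands in the deep triple,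
where it only enlarges the radical). Only `H` at `κ = κ'²/2` is used. [folklore] -/
theorem abc_pythagorean_of_balancedABC :
    (∀ κ : ℝ, 0 < κ → ∀ ε : ℝ, 0 < ε → ∃ C : ℝ, ∀ a b c : ℕ, IsABCTriple a b c →
      κ * (c : ℝ) ≤ (a : ℝ) → κ * (c : ℝ) ≤ (b : ℝ) → (c : ℝ) < C * ((rad a b c : ℕ) : ℝ) ^ (1 + ε)) →
    ∀ κ' : ℝ, 0 < κ' → ∀ ε : ℝ, 0 < ε → ∃ C : ℝ, ∀ x y : ℕ, 0 < x → x < y → Nat.Coprime x y →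
      κ' * (y : ℝ) ≤ (x : ℝ) →
        ((x ^ 2 + y ^ 2 : ℕ) : ℝ) < C * ((rad ((y - x) ^ 2) (2 * x * y) (x ^ 2 + y ^ 2) : ℕ) : ℝ) ^ (1 + ε) := by
  intro hH κ' hκ' ε hε
  obtain ⟨C, -, hC⟩ := lt_of_balanced_partner hH (κ' ^ 2 / 2) (by positivity) ε hε
  refine ⟨C, fun x y hx hxy hcop hbal => ?_⟩
  have hy : 0 < y := lt_trans hx hxy
  have hT := partner_pythagorean_isABCTriple hx hy hcop
  have hrad := rad_partner_le_rad_pythagorean hx hxy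
  have hx' : (0 : ℝ) < x := by exact_mod_cast hx
  have hxy' : (x : ℝ) < y := by exact_mod_cast hxy
  have hy' : (0 : ℝ) < y := by exact_mod_cast hy
  have hκ'1 : κ' ≤ 1 := by
    have h1 : κ' * (y : ℝ) < 1 * y := by linarith
    exact le_of_lt (lt_of_mul_lt_mul_right h1 hy'.le)
  have hbal1 : κ' ^ 2 / 2 * (((x ^ 2 + y ^ 2 : ℕ)) : ℝ) ≤ ((x ^ 2 : ℕ) : ℝ) := by
    push_cast
    have h1 : κ' ^ 2 * (y : ℝ) ^ 2 ≤ (x : ℝ) ^ 2 := by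
      have : 0 ≤ κ' * y := by positivity
      nlinarith
    have h2 : κ' ^ 2 * (x : ℝ) ^ 2 ≤ (x : ℝ) ^ 2 := by
      have : κ' ^ 2 ≤ 1 := by nlinarith
      nlinarith
    nlinarith
  have hbal2 : κ' ^ 2 / 2 * (((x ^ 2 + y ^ 2 : ℕ)) : ℝ) ≤ ((y ^ 2 : ℕ) : ℝ) := by
    push_cast
    have : κ' ^ 2 ≤ 1 := by nlinarith
    nlinarith
  exact hC ((y - x) ^ 2) (2 * x * y) (x ^ 2 + y ^ 2) (x ^ 2) (y ^ 2) (x ^ 2 + y ^ 2) hT hbal1 hbal2 hrad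

/-- `1 + 2m(m+1) = 2m² + 2m + 1` is an abc-triple. [folklore] -/
theorem consecutiveSquares_isABCTriple (m : ℕ) (hm : 1 ≤ m) :
    IsABCTriple 1 (2 * m * (m + 1)) (2 * m ^ 2 + 2 * m + 1) :=
  ⟨Nat.one_pos, by positivity, by ring, Nat.coprime_one_left _⟩

/-- **The simplest first tooth: `a = 1`, exponent `1`, same constant as `H`.** `H` implies abc (same `ε`) for every
triple `(1, 2m(m+1), m² + (m+1)²)`, `m ≥ 1` — the `x = m, y = m+1` line of the Pythagorean tooth, where the fresh
factor `y − x` equals `1`; the partner `(m², (m+1)², m²+(m+1)²)` has the SAME `c`. Only `H` at `κ = 1/8` is used.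
[folklore] -/
theorem abc_aEqOne_consecutiveSquares_of_balancedABC :
    (∀ κ : ℝ, 0 < κ → ∀ ε : ℝ, 0 < ε → ∃ C : ℝ, ∀ a b c : ℕ, IsABCTriple a b c →
      κ * (c : ℝ) ≤ (a : ℝ) → κ * (c : ℝ) ≤ (b : ℝ) → (c : ℝ) < C * ((rad a b c : ℕ) : ℝ) ^ (1 + ε)) →
    ∀ ε : ℝ, 0 < ε → ∃ C : ℝ, ∀ m : ℕ, 1 ≤ m →
      IsABCTriple 1 (2 * m * (m + 1)) (2 * m ^ 2 + 2 * m + 1) ∧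
      ((2 * m ^ 2 + 2 * m + 1 : ℕ) : ℝ) <
        C * ((rad 1 (2 * m * (m + 1)) (2 * m ^ 2 + 2 * m + 1) : ℕ) : ℝ) ^ (1 + ε) := by
  intro hH ε hε
  obtain ⟨C, hC⟩ := abc_pythagorean_of_balancedABC hH (1 / 2) (by norm_num) ε hε
  refine ⟨C, fun m hm => ⟨consecutiveSquares_isABCTriple m hm, ?_⟩⟩
  have hcop : Nat.Coprime m (m + 1) := by
    have e : m + 1 = 1 * m + 1 := by ring
    rw [e]; exact (Nat.coprime_mul_right_add_right m 1 1).mpr (Nat.coprime_one_right m)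
  have hbal : (1 / 2 : ℝ) * ((m + 1 : ℕ) : ℝ) ≤ (m : ℝ) := by
    have : (1 : ℝ) ≤ m := by exact_mod_cast hm
    push_cast; linarith
  have h := hC m (m + 1) (by omega) (by omega) hcop hbal
  have e1 : (m + 1 - m) ^ 2 = 1 := by simp
  have e3 : m ^ 2 + (m + 1) ^ 2 = 2 * m ^ 2 + 2 * m + 1 := by ring
  rw [e1, e3] at h
  exact h

end Summit.ABC.ABC.Theorems.CompactBalanceTransfer.FirstTooth
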